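import Summits.BirchSwinnertonDyer.BirchSwinnertonDyer.Theorems.SemiOrdinaryEisensteinDescentShaTwoCochainLocalInvariantsVanish
import Summits.BirchSwinnertonDyer.BirchSwinnertonDyer.Theorems.SemiOrdinaryEisensteinDescentShaTwoCochainBridgePackageMu
import Summits.BirchSwinnertonDyer.BirchSwinnertonDyer.Theorems.SemiOrdinaryEisensteinDescentShaTwoCochainLocalJoin
import Summits.BirchSwinnertonDyer.BirchSwinnertonDyer.Theorems.SemiOrdinaryEisensteinDescentCasselsTateLevelInputsOfPoitouTateAt
import Summits.BirchSwinnertonDyer.BirchSwinnertonDyer.Theorems.SemiOrdinaryEisensteinDescentShaTwoCochainReadoutVanishing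
import HarnessLib

/-!
# The Ш²-cochain bridge, FINAL ASSEMBLY modulo the global invariant sum (S3): `casselsTate_levelInputs K` for THE maps from ONE
# displayed statement «`Σ_v inv_{K_v} [π_v Z|_{Γ_v}] = classBarInv(Φ⁻¹[γ] ∘ ∂h)` for idèle `2`-cocycles `Z` with class image `h ∘ c`»

Route `SemiOrdinaryEisensteinDescent` (BSD, rung W-ALL row 2·3@3), Kolyvagin column, Cassels–Tate lane: print item
`CasselsTateLevelInputsFact` (stmt-BirchSwinnertonDyer-20191 = `∀ K, casselsTate_levelInputs K`, shared with routes KolyvaginRoadThree /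
ClassRecordThree / ErratumRoadFive as `ShimuraCasselsTateLevelInputs`).  The Ш²-cochain bridge (memo
`Cruxes/WildKolyvaginUpperAtThree/SHA2-BRIDGE-w3g7.md`) discharges its last input `hPTc` for THE canonical invariant maps.  This file
JOINS the landed links

* the shell `ShaTwoCochainTheta.casselsTate_levelInputs_of_readout_vanishing_flip` (p639762): CT(K) ⟸ «for the `h` exhausting
  `θ′_* [f]` and `y ∈ Ш¹(K, E[p^{M₀}])`, `classBarInv(Φ⁻¹ y ∘ ∂h) = 0`»;
* the `μ`-currency bridge package `ShaTwoCochain.exists_bridgePackageMu` (w3 g7, p641526): for `h` and `γ ∈ y` an admissible choice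
  `(H♭; φ♭_v)` for `(F♭, γ)`, `Ψ h = [F♭]`, an idèle `2`-cocycle `Z` with `jC ∘ Z = h ∘ c`, `[c] = δ₁[γ]`, and the per-place identity
  `ι_v κ (φ♭_v ∪ γ_v − H♭_v) = π_v Z|_v − dλ_v`; `H³(K, μ_{p^{2M₀}}) = 0` for odd `p` (`galoisCohomology_three_mu_eq_zero_of_ne_two`, w3 g4);
* the local projection cocycles `ShaTwoCochain.exists_localProjectionCocycle` (w3 g7, p641898);
* the local sum `ShaTwoCochainTheta.sum_brauerInvariantEquiv_localProjection_eq_zero_of_hPTc` (p642481): `Σ_{v ∈ T} inv_{K_v}[π_v Z|_v] = 0`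
  over every large finite set of finite places, under `hPTc`'s hypothesis,

leaving DISPLAYED exactly the GLOBAL INVARIANT SUM of cell bsd-schneider's class-field-theory layer (step S3, width seat w2 g11:
`…ShaTwoCochainIdeleDescent` ✓, `…IdeleInvariantSum`, and the `C̄`-side naturality): for a finite `n`-torsion `ρ₀`, `h : N₁ → C̄`,
`γ ∈ Z¹(K, M₀)`, `c ∈ Z²(K, N₁)` with `[c] = δ₁[γ]`, a lift `h̃` of `h`, and an idèle `2`-cocycle `Z` with `jC (Z(σ,τ)) = h(c(σ,τ))`:
`Σ_{v ∈ T} inv_{K_v} [π_v Z|_{Γ_v}] = classBarInv K ((Φ⁻¹ [γ]) ∘ ∂h)` over every large finite set `T` of finite places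
(`hS3`; conjuncts (3)(4)(5) of the package are its hypotheses; THE idèle projections).

* **`hbridge_of_globalInvariantSum`** — `hS3` ⟹ the shell's binder `hbridge` (flipped currency), VERBATIM the hypothesis of
  `ShaTwoCochainTheta.casselsTate_levelInputs_of_readout_vanishing_flip` (p639762); so `casselsTate_levelInputs K` for THE maps is
  `casselsTate_levelInputs_of_readout_vanishing_flip K (hbridge_of_globalInvariantSum K hS3)` — the one-line closer lands with
  `hS3` discharged (S3, w2 g11), as `…ShaTwoCochainCasselsTate.lean`.

THEOREMS ONLY (no definition, no instance, no named fact); a reduction with ONE displayed hypothesis on existing objects; no case of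
BSD, Poitou–Tate or Cassels–Tate is proved here.  Width seat `bsd-wall-soed-p2-w4` g2 (glue owner); `--supports
stmt-BirchSwinnertonDyer-20480`, helper; route-free.

## References
* [MilneADT2006] J. S. Milne, *Arithmetic Duality Theorems*, 2nd ed. (2006), Ch. I Thm. 4.10 (a) and its proof (pp. 57–58),
  Lemma 4.13, §1, §6 Prop. 6.9 / Thm. 6.13 (a) (p. 88).
* [CasselsFrohlichANT1967] J. W. S. Cassels, A. Fröhlich (eds.), *Algebraic Number Theory* (1967), Ch. VII §9.6, §10, §11.2 (bis).
* [SerreGaloisCohomology1997] J.-P. Serre, *Galois Cohomology* (1997), II §4.4 Prop. 13 (`cd_p Γ_K ≤ 2`, `p` odd).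
-/

noncomputable section

open scoped Classical
open Function NumberField IsDedekindDomain CategoryTheory CategoryTheory.Abelian
open scoped NumberField ContRepresentation

-- `Summit.<P>.<Sub>` repeats `BirchSwinnertonDyer` by the tree's layout convention (D-0017)
set_option linter.dupNamespace false
set_option autoImplicit false

namespace Summit.BirchSwinnertonDyer.BirchSwinnertonDyer.Theorems.ShaTwoCochainTheta

open _root_.WeierstrassCurve Field
open Literature.NumberTheory.EllipticCurves
open Literature.NumberTheory.GaloisRepresentations Literature.NumberTheory.GaloisCohomology
open Literature.NumberTheory.GaloisRepresentations.DiscreteGaloisModule (mu MuCarrier units UnitsCarrier pairing TateDual tateDual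
  tateDualPairing pairingDualHom pairingDualIntertwining sha shaTwo)
open Literature.Algebra.Homology Literature.Algebra.Homology.DiscreteRep Literature.Algebra.Homology.ExtPresentation
open Literature.NumberTheory.GaloisRepresentations.IdeleClassBar (classBarD classBarInv)
open Literature.NumberTheory.GaloisRepresentations.HomDual
open Literature.NumberTheory.GaloisRepresentations.FreePresentation (presentationComplex presentationComplex_shortExact presModule₁
  pres_isSES moduleFinite_presModule₁)
open Literature.NumberTheory.GaloisRepresentations.DGMBridge
open Literature.NumberTheory.GaloisRepresentations.OpenLayer (extOneEquiv)
open Literature.AnabelianGeometry.AbsoluteAnabelian (Prop121vii.brauerInvariantEquiv Prop121vii.zmodToQmodZ)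
open Summit.BirchSwinnertonDyer.BirchSwinnertonDyer.Theorems.ShaTwoCochain
open Summit.BirchSwinnertonDyer.BirchSwinnertonDyer.Theorems.CasselsTateLemma615OfPT (galoisCohomology_three_mu_eq_zero_of_ne_two)

variable (K : Type) [Field K] [NumberField K]

/-- **The shell's binder from the global invariant sum (S3).**  For every `W/ℚ` elliptic, odd prime `p`, `M₀ ≥ 1`, Weil-type
alternating non-degenerate `e`, every `2`-cocycle `f` of `E[p^{M₀}]` with `hPTc`'s hypothesis, every `h` with `Ψ h = θ′_* [f]` and
every `y ∈ Ш¹(K, E[p^{M₀}])`: `classBarInv(Φ⁻¹ y ∘ ∂h) = 0` — GIVEN the displayed identity `hS3` of the global invariant sum.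
Proof: pick `γ ∈ y`; `exists_bridgePackageMu` (`H³(K, μ) = 0` at odd level); choose the local data at THE idèle projections; the
local projection cocycles exist (`exists_localProjectionCocycle`); `hS3` reads their invariant sum as `classBarInv(Φ⁻¹[γ] ∘ ∂h)`
over large `T`, and `sum_brauerInvariantEquiv_localProjection_eq_zero_of_hPTc` makes that sum vanish over large `T`.
[cite: MilneADT2006, Ch. I Thm. 4.10 (a) (proof, pp. 57–58), Lemma 4.13][cite: CasselsFrohlichANT1967, Ch. VII §11.2 (bis)] -/
theorem hbridge_of_globalInvariantSum
    (hS3 : ∀ (n : ℕ) [NeZero n] {M : Type} [AddCommGroup M] [TopologicalSpace M] [DiscreteTopology M] [Finite M]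
      (ρ₀ : DiscreteGaloisModule K M) (hM : ∀ m : M, n • m = 0)
      (h : (presentationComplex ρ₀).X₁ ⟶ classBarD K) (γ : contOneCocycles ρ₀.toTopRep)
      (c : contTwoCocycles (presModule₁ ρ₀).toTopRep)
      (ht : DiscreteRep.HomCarrier (LCarrier (presentationComplex ρ₀).X₁) (LCarrier (ideleBarD K)))
      (Z : contTwoCocycles (toDGM (ideleBarD K)).toTopRep),
      haveI := moduleFinite_presModule₁ ρ₀
      haveI := absoluteGaloisGroup_compactSpace K
      (∀ x : LCarrier (presentationComplex ρ₀).X₁,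
        ideleToClassI K ((show _ →ₗ[ℤ] LCarrier (ideleBarD K) from ht) x) = lmap (presentationComplex ρ₀).X₁ (classBarD K) h x) →
      (pres_isSES ρ₀).δ₁ (oneCocycleClass _ γ) = twoCocycleClass _ c →
      (∀ σ τ : absoluteGaloisGroup K,
        ideleToClassI K (Z.1 (σ, τ)) = lmap (presentationComplex ρ₀).X₁ (classBarD K) h (c.1 (σ, τ))) →
      ∀ (cZ : (v : HeightOneSpectrum (𝓞 K)) → contTwoCocycles (units (v.adicCompletion K)).toTopRep),
        (∀ (v : HeightOneSpectrum (𝓞 K)) (s t : absoluteGaloisGroup (v.adicCompletion K)),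
          (cZ v).1 (s, t) = ((IdeleReadout.ideleProjection K (Sum.inr v)).toAddMonoidHom.comp (LCarrier.val (ideleBarD K)))
            (Z.1 (absGaloisRestrict K (v.adicCompletion K) s, absGaloisRestrict K (v.adicCompletion K) t))) →
        ∃ Tf : Finset (HeightOneSpectrum (𝓞 K)), ∀ T : Finset (HeightOneSpectrum (𝓞 K)), Tf ⊆ T →
          ∑ v ∈ T, (haveI := charZero_adicCompletion v; haveI := absoluteGaloisGroup_compactSpace (v.adicCompletion K);
              Prop121vii.brauerInvariantEquiv (v.adicCompletion K)
                (twoCocycleClass (units (v.adicCompletion K)).toTopRep (cZ v))) =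
            classBarInv K (((extOneEquiv ρ₀).symm (oneCocycleClass _ γ)).comp
              (boundary (presentationComplex_shortExact ρ₀) (classBarD K) h) (rfl : 1 + 1 = 2))) :
    ∀ (W : WeierstrassCurve ℚ) [W.IsElliptic] (p M₀ : ℕ), p.Prime → p ≠ 2 → 1 ≤ M₀ →
      ∀ [NeZero (p ^ M₀)] [NeZero (p ^ M₀ * p ^ M₀)] [Finite (geomTorsion (W.baseChange K) ((p ^ M₀ : ℕ) : ℤ))]
        (e : geomTorsion (W.baseChange K) ((p ^ M₀ * p ^ M₀ : ℕ) : ℤ) →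
          geomTorsion (W.baseChange K) ((p ^ M₀ * p ^ M₀ : ℕ) : ℤ) → AlgebraicClosure K)
        (hμ : ∀ S T, e S T ^ (p ^ M₀ * p ^ M₀) = 1)
        (hadd₁ : ∀ S₁ S₂ T, e (S₁ + S₂) T = e S₁ T * e S₂ T)
        (hadd₂ : ∀ S T₁ T₂, e S (T₁ + T₂) = e S T₁ * e S T₂)
        (hgal : ∀ (σ : absoluteGaloisGroup K)
          (S T : geomTorsion (W.baseChange K) ((p ^ M₀ * p ^ M₀ : ℕ) : ℤ)), σ • e S T = e (σ • S) (σ • T)),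
        (∀ T, e T T = 1) → (∀ T, (∀ S, e S T = 1) → T = 0) →
        ∀ f : contTwoCocycles ((W.baseChange K).torsionGaloisModule ((p ^ M₀ : ℕ) : ℤ)).toTopRep,
          (∀ g : contOneCocycles ((W.baseChange K).torsionGaloisModule ((p ^ M₀ : ℕ) : ℤ)).toTopRep,
            (∀ v : Place K, locClass ((W.baseChange K).torsionGaloisModule ((p ^ M₀ : ℕ) : ℤ))
                (Place.Completion v)
                (resOne ((W.baseChange K).torsionGaloisModule ((p ^ M₀ : ℕ) : ℤ)) (Place.Completion v) g) = 0) →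
            ∃ (C : PTChoice (W.baseChange K) (p ^ M₀) e hμ hadd₁ hadd₂ hgal f g) (S : Finset (Place K)),
              (∀ v ∉ S, C.localTerm (LocalInvariants.canonical K (p ^ M₀ * p ^ M₀)) v = 0) ∧
                ∑ v ∈ S, C.localTerm (LocalInvariants.canonical K (p ^ M₀ * p ^ M₀)) v = 0) →
          ∀ h : (presentationComplex ((W.baseChange K).torsionGaloisModule ((p ^ M₀ : ℕ) : ℤ))).X₁ ⟶ classBarD K,
            shaTwoConnecting ((W.baseChange K).torsionGaloisModule ((p ^ M₀ : ℕ) : ℤ)) (p ^ M₀ * p ^ M₀)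
                (FirstCaseData.mul_nsmul_geomTorsion_eq_zero (W := W.baseChange K) (m := p ^ M₀)) h =
              galoisCohomology.map (pairingDualIntertwining
                (ρ₁ := (W.baseChange K).torsionGaloisModule ((p ^ M₀ : ℕ) : ℤ))
                (ρ₂ := (W.baseChange K).torsionGaloisModule ((p ^ M₀ : ℕ) : ℤ))
                (B := (descendHom (W.baseChange K) (p ^ M₀) (p ^ M₀) e hμ hadd₁ hadd₂).flip)
                (descendHom_flip_smul (W.baseChange K) (p ^ M₀) e hμ hadd₁ hadd₂ hgal)) 2
                (twoCocycleClass _ f) →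
            ∀ y ∈ sha ((W.baseChange K).torsionGaloisModule ((p ^ M₀ : ℕ) : ℤ)),
              classBarInv K (((extOneEquiv ((W.baseChange K).torsionGaloisModule ((p ^ M₀ : ℕ) : ℤ))).symm y).comp
                (boundary (presentationComplex_shortExact ((W.baseChange K).torsionGaloisModule ((p ^ M₀ : ℕ) : ℤ)))
                  (classBarD K) h) (rfl : 1 + 1 = 2)) = 0 := by
  intro W _ p M₀ hp hp2 hM₀ _ _ _ e hμ hadd₁ hadd₂ hgal halt hnd f hf h hh y hy
  haveI := absoluteGaloisGroup_compactSpace K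
  -- the level is odd and `H³(K, μ_{p^{2M₀}}) = 0`
  have hodd : Odd (p ^ M₀ * p ^ M₀) := (hp.odd_of_ne_two hp2).pow.mul (hp.odd_of_ne_two hp2).pow
  haveI : Fact p.Prime := ⟨hp⟩
  haveI : NeZero (p ^ (M₀ + M₀)) := ⟨pow_ne_zero _ hp.ne_zero⟩
  have hH3 : ∀ z : galoisCohomology (mu K (p ^ M₀ * p ^ M₀)) 3, z = 0 := by
    rw [← pow_add]
    exact fun z => galoisCohomology_three_mu_eq_zero_of_ne_two K p (M₀ + M₀) hp2 z
  -- a cocycle `γ ∈ y`, locally trivial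
  obtain ⟨γ, rfl⟩ := oneCocycleClass_surjective _ y
  have hγ := (oneCocycleClass_mem_sha_iff_locClass ((W.baseChange K).torsionGaloisModule ((p ^ M₀ : ℕ) : ℤ)) γ).1 hy
  -- the bridge package in `μ`-currency
  obtain ⟨Fb, Hb, c, ht, Z, h1, h2, h3, h4, h5, h6⟩ :=
    exists_bridgePackageMu ((W.baseChange K).torsionGaloisModule ((p ^ M₀ : ℕ) : ℤ)) (p ^ M₀ * p ^ M₀)
      (FirstCaseData.mul_nsmul_geomTorsion_eq_zero (W := W.baseChange K) (m := p ^ M₀)) hH3 h γ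
  -- local data at THE idèle projections, every place; local projection cocycles at the finite places
  choose φb lam hφb h6' using fun v : Place K => h6 v (IdeleReadout.ideleProjection K v)
  choose cZ hcZ using fun v : HeightOneSpectrum (𝓞 K) =>
    exists_localProjectionCocycle Z (Sum.inr v) (IdeleReadout.ideleProjection K (Sum.inr v))
  -- S3: the invariant sum over large `T` is the readout value
  obtain ⟨Tf, hTf⟩ := hS3 (p ^ M₀ * p ^ M₀) ((W.baseChange K).torsionGaloisModule ((p ^ M₀ : ℕ) : ℤ))
    (FirstCaseData.mul_nsmul_geomTorsion_eq_zero (W := W.baseChange K) (m := p ^ M₀)) h γ c ht Z h3 h4 h5 cZ hcZ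
  -- the local side: the invariant sum over large `T` vanishes
  obtain ⟨S₀, hS₀⟩ := sum_brauerInvariantEquiv_localProjection_eq_zero_of_hPTc (hgal := hgal) hodd hf Fb (hh.symm.trans h1)
    hγ Hb h2 φb hφb Z (fun v => IdeleReadout.ideleProjection K (Sum.inr v)) cZ hcZ (fun v => lam (Sum.inr v))
    (fun v => h6' (Sum.inr v))
  rw [← hTf (Tf ∪ S₀) Finset.subset_union_left]
  exact hS₀ (Tf ∪ S₀) Finset.subset_union_right

end Summit.BirchSwinnertonDyer.BirchSwinnertonDyer.Theorems.ShaTwoCochainTheta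

end
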